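import Literature.Topology.PlaneTopology.Janiszewski
import Literature.Topology.PlaneTopology.LocallyConnectedContinua
import Literature.Probability.RandomPlanarGeometry.CaratheodoryContinuity
import HarnessLib

/-!
# Carathéodory's continuity theorem for domains with uniformly locally connected boundary cover

Pommerenke, *Boundary Behaviour of Conformal Maps* (1992), Thm. 2.1: for a conformal map `f` of
the unit disc `𝔻` onto a bounded domain `G`, the four conditions (i) `f` has a continuous
extension to the closed disc, (ii) `∂G` is a curve, (iii) `∂G` is locally connected,
(iv) `ℂ ∖ G` is locally connected, are equivalent. The tree proves (ii) ⇒ (i) for *Jordan*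
domains (`Literature.Probability.RandomPlanarGeometry.CaratheodoryContinuity`, JCT-free, via
Janiszewski's theorem). Here we run **the same proof** (op. cit., p. 21, (iv) ⇒ (i)) under the
hypothesis it actually uses, in the form needed for the Loewner trace
(`Literature.Probability.RandomPlanarGeometry.LoewnerTraceLimit`, where `G` is a Möbius image of
a slit half-plane `ℍₒ ∖ K_t` and is not a Jordan domain):

> `G` is open, preconnected and bounded, and there is a **uniformly locally connected** set `P`
> (`Literature.Topology.PlaneTopology.IsUniformlyLocallyConnected`, Pommerenke §2.2) with `∂G ⊆ P ⊆ ℂ ∖ G`.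

Then `φ : 𝔻 → G` conformal extends continuously to the closed disc
(`Literature.Probability.RandomPlanarGeometry.ConformalEquiv.continuousOn_extendFrom_of_cover`). For instance `P = ∂G` when `∂G` is a
curve (Pommerenke (ii); a Jordan domain qualifies with `P = ∂D`, the small continua being short
boundary arcs, `JordanDomain.exists_short_arc`, so the Jordan case of `CaratheodoryContinuity` is
the instance `P = frontier D`), or `P = γ[0,t] ∪ (a circle)` for the complement of a Loewner
hull generated by a curve `γ`. This is Pommerenke's (iv) ⇒ (i) *in the uniform-continuum form
in which (iv) is used in the proof*; the reduction from "`ℂ ∖ G` locally connected" (pointwise)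
to this form is not formalised here.

Proof — the argument of `CaratheodoryContinuity` (whose four steps are repeated here with the
Jordan-specific inputs `D.exists_short_arc`, `σ ⊆ frontier D` replaced by the cover `P`; the
D-independent helpers `JordanDomain.isPreconnected_setOf_lt_dist`, `JordanDomain.norm_cpt_arccos`
and the `LengthArea` API are used from the tree, nothing is restated): by Wolff's length–area lemma
(`Literature.Analysis.Complex.LengthArea.exists_short_crosscut_of_isBounded`) there are arbitrarily short crosscuts
`C = φ(𝔻 ∩ {|w - ζ| = r})` near a boundary point `ζ`, with endpoints `a, b ∈ ∂G ⊆ P`; uniform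
local connectedness of `P` joins `a, b` by a small continuum `σ ⊆ P ⊆ ℂ ∖ G`; by Janiszewski's
theorem (`Literature.Topology.PlaneTopology.janiszewski'`) applied to `A = C̄ ∪ σ` (small) and `B = (ℂ ∖ G) ∩ B̄(0, R₁)`
(with `A ∩ B = σ` connected), a point of the near side `φ(𝔻 ∩ {|w - ζ| < r})` far from `a`
would be joined to `φ 0` inside `G ∖ C`, which pulled back to the disc contradicts the
intermediate value theorem for `|· - ζ|` (`image_inter_ball_subset_of_cover`). Hence `φ`
oscillates little near `ζ`, has a limit there, and `extendFrom 𝔻 φ` is continuous on the closed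
disc.

## References

* Ch. Pommerenke, *Boundary Behaviour of Conformal Maps*, Springer (1992), §2.2, Thm. 2.1 and
  its proof (p. 21), Prop. 2.2 (length–area).
-/

noncomputable section

open Set Filter Metric Topology Complex Real
open scoped NNReal

namespace Literature.Probability.RandomPlanarGeometry

namespace ConformalEquiv

open Literature.Analysis.Complex.LengthArea

variable {G : Set ℂ} (φ : ConformalEquiv (ball (0 : ℂ) 1) G) {ζ : ℂ} {r : ℝ}

/-- **The near side of a short crosscut is small** (Janiszewski). Let `G` be open, preconnected
and bounded, `C` the crosscut `t ↦ φ (ζ - ζ r e^{it})`, `|t| < arccos (r/2)`, with endpoints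
`a, b`, and `σ ⊆ ℂ ∖ G` a compact preconnected set containing `a` and `b`, everything inside the
closed disc of radius `R` about `a`, with `dist (φ 0) a > R`. Then `φ` maps
`𝔻 ∩ {|w - ζ| < r}` into that disc. Pommerenke (1992), proof of Thm. 2.1 ((iv) ⇒ (i), p. 21).
[cite: PommerenkeBBCM1992, Thm. 2.1 (proof)] -/
theorem image_inter_ball_subset_of_cover (hG : IsOpen G) (hGc : IsPreconnected G)
    (hGb : Bornology.IsBounded G) (hζ : ‖ζ‖ = 1) (hr : r ∈ Ioo (0 : ℝ) 1)
    {a b : ℂ} (ha : Tendsto (fun t ↦ φ (cpt ζ r t)) (𝓝[>] (-arccos (r / 2))) (𝓝 a))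
    (hb : Tendsto (fun t ↦ φ (cpt ζ r t)) (𝓝[<] (arccos (r / 2))) (𝓝 b))
    {σ : Set ℂ} (hσc : IsPreconnected σ) (hσK : IsCompact σ) (hσG : Disjoint σ G)
    (haσ : a ∈ σ) (hbσ : b ∈ σ) {R : ℝ}
    (hRc : ∀ t ∈ Ioo (-arccos (r / 2)) (arccos (r / 2)), dist (φ (cpt ζ r t)) a ≤ R)
    (hRσ : σ ⊆ closedBall a R) (hfar : R < dist (φ 0) a) :
    φ '' (ball 0 1 ∩ ball ζ r) ⊆ closedBall a R := by
  set α := arccos (r / 2) with hα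
  have hαpos : 0 < α := arccos_pos.2 (by linarith [hr.2])
  have hαpi : α ≤ π := arccos_le_pi _
  have hR0 : 0 ≤ R := dist_nonneg.trans (hRσ hbσ)
  have hmem : ∀ t ∈ Ioo (-α) α, cpt ζ r t ∈ ball (0 : ℂ) 1 := fun t ht ↦ by
    have habs : |t| < α := abs_lt.2 ht
    exact (mem_ball_cpt_iff_abs_lt hζ hr.1 (by linarith [hr.2]) (habs.le.trans hαpi)).2 habs
  set c : ℝ → ℂ := fun t ↦ φ (cpt ζ r t) with hc
  set C : Set ℂ := c '' Ioo (-α) α with hCdef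
  have hCD : C ⊆ G := by
    rintro _ ⟨t, ht, rfl⟩
    exact φ.mapsTo (hmem t ht)
  have hCR : C ⊆ closedBall a R := by
    rintro _ ⟨t, ht, rfl⟩
    exact mem_closedBall.2 (hRc t ht)
  -- the closed crosscut `C̄ = C ∪ {a, b}` as a continuous image of `[-α, α]`
  have hcc : ContinuousOn c (Ioo (-α) α) :=
    φ.continuousOn.comp (continuous_cpt ζ r).continuousOn hmem
  have hlt : -α < α := by linarith
  set cbar : ℝ → ℂ := extendFrom (Ioo (-α) α) c with hcbar
  have hcbar_c : ContinuousOn cbar (Icc (-α) α) := continuousOn_Icc_extendFrom_Ioo hcc ha hb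
  have hcbar_a : cbar (-α) = a := eq_lim_at_left_extendFrom_Ioo hlt ha
  have hcbar_b : cbar α = b := eq_lim_at_right_extendFrom_Ioo hlt hb
  have hcbar_eq : ∀ t ∈ Ioo (-α) α, cbar t = c t := fun t ht ↦
    extendFrom_extends hcc t ht
  set Cbar : Set ℂ := cbar '' Icc (-α) α with hCbar
  have hCbarK : IsCompact Cbar := (isCompact_Icc).image_of_continuousOn hcbar_c
  have hCbar_sub : Cbar ⊆ C ∪ {a, b} := by
    rintro _ ⟨t, ht, rfl⟩
    rcases eq_or_lt_of_le ht.1 with h1 | h1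
    · exact Or.inr (Or.inl (by rw [← h1, hcbar_a]))
    rcases eq_or_lt_of_le ht.2 with h2 | h2
    · exact Or.inr (Or.inr (by rw [h2, hcbar_b]; exact mem_singleton b))
    · exact Or.inl ⟨t, ⟨h1, h2⟩, (hcbar_eq t ⟨h1, h2⟩).symm⟩
  have hC_sub : C ⊆ Cbar := by
    rintro _ ⟨t, ht, rfl⟩
    exact ⟨t, Ioo_subset_Icc_self ht, hcbar_eq t ht⟩
  -- the two compact sets of Janiszewski's theorem
  set A : Set ℂ := Cbar ∪ σ with hA
  have hAK : IsCompact A := hCbarK.union hσK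
  have hAR : A ⊆ closedBall a R := by
    refine union_subset (hCbar_sub.trans (union_subset hCR ?_)) hRσ
    rintro x (rfl | rfl)
    · exact mem_closedBall_self hR0
    · exact hRσ hbσ
  obtain ⟨R₁, hR₁⟩ := (isBounded_iff_subset_closedBall 0).1 (hGb.union hσK.isBounded)
  set B : Set ℂ := Gᶜ ∩ closedBall 0 R₁ with hB
  have hBK : IsCompact B := (isCompact_closedBall 0 R₁).inter_left hG.isClosed_compl
  have hDR₁ : G ⊆ closedBall 0 R₁ := subset_union_left.trans hR₁
  have hσB : σ ⊆ B := fun x hx ↦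
    ⟨fun hxD ↦ hσG.le_bot ⟨hx, hxD⟩, hR₁ (Or.inr hx)⟩
  have hAB : A ∩ B = σ := by
    refine Subset.antisymm ?_ fun x hx ↦ ⟨Or.inr hx, hσB hx⟩
    rintro x ⟨hxA, hxB⟩
    rcases hxA with hxC | hxσ
    · rcases hCbar_sub hxC with hxC' | (rfl | rfl)
      · exact absurd (hCD hxC') hxB.1
      · exact haσ
      · exact hbσ
    · exact hxσ
  -- suppose some `w = φ z` of the near side is far from `a`
  rintro w ⟨z, ⟨hz, hzr⟩, rfl⟩
  by_contra hwR
  rw [mem_closedBall, not_le] at hwR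
  have h0D : φ 0 ∈ G := φ.mapsTo (mem_ball_self one_pos)
  have hwD : φ z ∈ G := φ.mapsTo hz
  -- neither `A` nor `B` separates `φ 0` from `φ z`
  have hSA : ∃ S ⊆ Aᶜ, IsPreconnected S ∧ φ 0 ∈ S ∧ φ z ∈ S :=
    ⟨{x | R < dist x a}, fun x hx hxA ↦ (not_le.2 hx) (mem_closedBall.1 (hAR hxA)),
      JordanDomain.isPreconnected_setOf_lt_dist a hR0, hfar, hwR⟩
  have hSB : ∃ S ⊆ Bᶜ, IsPreconnected S ∧ φ 0 ∈ S ∧ φ z ∈ S :=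
    ⟨G, fun x hx hxB ↦ hxB.1 hx, hGc, h0D, hwD⟩
  obtain ⟨V, hV, hVc, h0V, hwV⟩ :=
    Literature.Topology.PlaneTopology.janiszewski' hAK hBK (hAB ▸ hσc) hSA hSB
  -- `V ⊆ G ∖ C`
  have hVD : V ⊆ G := by
    have hcov : V ⊆ G ∪ (closedBall (0 : ℂ) R₁)ᶜ := by
      intro x hx
      by_cases hxD : x ∈ G
      · exact Or.inl hxD
      · exact Or.inr fun hxR ↦ hV hx (Or.inr ⟨hxD, hxR⟩)
    refine hVc.subset_left_of_subset_union hG isClosed_closedBall.isOpen_compl ?_ hcov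
      ⟨φ 0, h0V, h0D⟩
    exact Set.disjoint_left.2 fun x hxD hxR ↦ hxR (hDR₁ hxD)
  have hVC : ∀ x ∈ V, x ∉ C := fun x hx hxC ↦ hV hx (Or.inl (Or.inl (hC_sub hxC)))
  -- pull back to the disc and apply the intermediate value theorem to `|· - ζ|`
  set V' : Set ℂ := φ.symm '' V with hV'
  have hV'c : IsPreconnected V' := hVc.image _ (φ.symm.continuousOn.mono hVD)
  have hV'ball : V' ⊆ ball 0 1 := by
    rintro _ ⟨x, hx, rfl⟩
    exact φ.symm_mapsTo (hVD hx)
  have h0V' : (0 : ℂ) ∈ V' := ⟨φ 0, h0V, φ.symm_apply_apply (mem_ball_self one_pos)⟩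
  have hzV' : z ∈ V' := ⟨φ z, hwV, φ.symm_apply_apply hz⟩
  have hfc : ContinuousOn (fun x : ℂ ↦ ‖x - ζ‖) V' := by fun_prop
  have hfz : ‖z - ζ‖ < r := by rwa [mem_ball, dist_eq_norm] at hzr
  have hf0 : ‖(0 : ℂ) - ζ‖ = 1 := by rw [zero_sub, norm_neg, hζ]
  obtain ⟨u, huV', hur⟩ : ∃ u ∈ V', ‖u - ζ‖ = r := by
    obtain ⟨u, hu, hur⟩ :=
      hV'c.intermediate_value hzV' h0V' hfc ⟨hfz.le, by rw [hf0]; exact hr.2.le⟩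
    exact ⟨u, hu, hur⟩
  obtain ⟨x, hxV, rfl⟩ := huV'
  have hxD : x ∈ G := hVD hxV
  have hφu : φ (φ.symm x) = x := φ.apply_symm_apply hxD
  have hmemC : φ (φ.symm x) ∈ C := by
    -- points of the disc at distance exactly `r` from `ζ` are on the crosscut
    obtain ⟨t, ht, hteq⟩ := exists_eq_cpt hζ hr.1 hur
    have habs : |t| ≤ π := abs_le.2 ⟨ht.1.le, ht.2⟩
    have hlt' := (mem_ball_cpt_iff_abs_lt hζ hr.1 (by linarith [hr.2]) habs).1
      (hteq ▸ hV'ball ⟨x, hxV, rfl⟩)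
    exact ⟨t, abs_lt.1 hlt', by rw [hc, hteq]⟩
  rw [hφu] at hmemC
  exact hVC x hxV hmemC

variable {P : Set ℂ}

/-- **Equicontinuity at a boundary point.** If `G` is open, preconnected and bounded and `P` is
a uniformly locally connected set with `∂G ⊆ P ⊆ ℂ ∖ G`, then for every `ε₀ > 0` there
is `ρ > 0` such that `φ` oscillates by less than `ε₀` on `𝔻 ∩ {|w - ζ| < ρ}` (short crosscut by
length–area, small continuum of `P` joining its endpoints, `image_inter_ball_subset_of_cover`).
Pommerenke (1992), proof of Thm. 2.1 (p. 21). [cite: PommerenkeBBCM1992, Thm. 2.1 (proof)] -/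
theorem exists_forall_dist_lt_of_cover (hG : IsOpen G) (hGc : IsPreconnected G)
    (hGb : Bornology.IsBounded G) (hP : Literature.Topology.PlaneTopology.IsUniformlyLocallyConnected P)
    (hfrP : frontier G ⊆ P) (hPG : Disjoint P G) (hζ : ‖ζ‖ = 1) {ε₀ : ℝ} (hε₀ : 0 < ε₀) :
    ∃ ρ > 0, ∀ z ∈ ball (0 : ℂ) 1, dist z ζ < ρ → ∀ z' ∈ ball (0 : ℂ) 1, dist z' ζ < ρ →
      dist (φ z) (φ z') < ε₀ := by
  -- `φ 0` is at positive distance `d₀` from `∂G`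
  obtain ⟨d₀, hd₀, hballΩ⟩ := Metric.isOpen_iff.1 hG (φ 0) (φ.mapsTo (mem_ball_self one_pos))
  have hfarJ : ∀ a ∈ frontier G, d₀ ≤ dist (φ 0) a := fun a ha ↦ by
    by_contra h
    have haG : a ∈ G := hballΩ (by rw [mem_ball']; exact not_le.1 h)
    exact hPG.le_bot ⟨hfrP ha, haG⟩
  set η := min (ε₀ / 4) (d₀ / 2) with hη
  have hηpos : 0 < η := lt_min (by linarith) (by linarith)
  obtain ⟨ε₁, hε₁, harc⟩ := hP η hηpos
  set ε := min (ε₁ / 2) η with hε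
  have hεpos : 0 < ε := lt_min (by linarith) hηpos
  have hbdd : Bornology.IsBounded (φ '' ball 0 1) := by rw [φ.bijOn.image_eq]; exact hGb
  obtain ⟨r, hr, -, a, b, ha, hb, hRc, hRb⟩ :=
    exists_short_crosscut_of_isBounded φ.differentiableOn φ.injOn hbdd hζ hεpos
  -- the endpoints of the crosscut are boundary points of `G`
  have hfront : ∀ {l : Filter ℝ} [NeBot l] {g : ℝ → ℂ}, (∀ᶠ t in l, g t ∈ ball (0 : ℂ) 1) →
      ∀ {x : ℂ}, ‖x‖ = 1 → Tendsto g l (𝓝 x) → ∀ {a : ℂ}, Tendsto (fun t ↦ φ (g t)) l (𝓝 a) →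
        a ∈ frontier G := by
    intro l _ g hg x hx hgx a ha'
    have hcl : a ∈ closure G := mem_closure_of_tendsto ha' (hg.mono fun t ht ↦ φ.mapsTo ht)
    rw [closure_eq_self_union_frontier] at hcl
    refine hcl.resolve_left fun haD ↦ ?_
    have hsymm : ContinuousAt φ.symm a := (φ.symm.continuousOn a haD).continuousAt (hG.mem_nhds haD)
    have h1 : Tendsto (fun t ↦ φ.symm (φ (g t))) l (𝓝 (φ.symm a)) := hsymm.tendsto.comp ha'
    have h2 : Tendsto (fun t ↦ φ.symm (φ (g t))) l (𝓝 x) :=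
      hgx.congr' (hg.mono fun t ht ↦ (φ.symm_apply_apply ht).symm)
    have h3 := tendsto_nhds_unique h1 h2
    have hmem := φ.symm_mapsTo haD
    rw [h3, mem_ball_zero_iff, hx] at hmem
    exact lt_irrefl _ hmem
  set α := arccos (r / 2) with hα
  have hαpos : 0 < α := arccos_pos.2 (by linarith [hr.2])
  have hαpi : α ≤ π := arccos_le_pi _
  have hmemα : ∀ t ∈ Ioo (-α) α, cpt ζ r t ∈ ball (0 : ℂ) 1 := fun t ht ↦ by
    have habs : |t| < α := abs_lt.2 ht
    exact (mem_ball_cpt_iff_abs_lt hζ hr.1 (by linarith [hr.2]) (habs.le.trans hαpi)).2 habs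
  have haJ : a ∈ frontier G :=
    hfront (l := 𝓝[>] (-α)) (by
      filter_upwards [Ioo_mem_nhdsGT (by linarith : -α < α)] with t ht using hmemα t ht)
      (JordanDomain.norm_cpt_arccos hζ hr (-α) (by rw [abs_neg, abs_of_pos hαpos]))
      (((continuous_cpt ζ r).tendsto (-α)).mono_left nhdsWithin_le_nhds) ha
  have hbJ : b ∈ frontier G :=
    hfront (l := 𝓝[<] α) (by
      filter_upwards [Ioo_mem_nhdsLT (by linarith : -α < α)] with t ht using hmemα t ht)
      (JordanDomain.norm_cpt_arccos hζ hr α (abs_of_pos hαpos))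
      (((continuous_cpt ζ r).tendsto α).mono_left nhdsWithin_le_nhds) hb
  obtain ⟨σ, hσP, hσK, hσc, haσ, hbσ, hσball⟩ := harc a (hfrP haJ) b (hfrP hbJ)
    (hRb.trans_lt (by
      calc ε ≤ ε₁ / 2 := min_le_left _ _
        _ < ε₁ := by linarith))
  have hεη : ε ≤ η := min_le_right _ _
  have hσG : Disjoint σ G := hPG.mono_left hσP
  have hW := image_inter_ball_subset_of_cover φ hG hGc hGb hζ hr ha hb hσc hσK hσG haσ hbσ
    (R := η) (fun t ht ↦ (hRc t ht).trans hεη) hσball (by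
      calc η ≤ d₀ / 2 := min_le_right _ _
        _ < d₀ := by linarith
        _ ≤ dist (φ 0) a := hfarJ a haJ)
  refine ⟨r, hr.1, fun z hz hzr z' hz' hz'r ↦ ?_⟩
  have h1 : φ z ∈ closedBall a η := hW ⟨z, ⟨hz, hzr⟩, rfl⟩
  have h2 : φ z' ∈ closedBall a η := hW ⟨z', ⟨hz', hz'r⟩, rfl⟩
  rw [mem_closedBall] at h1 h2
  calc dist (φ z) (φ z') ≤ dist (φ z) a + dist (φ z') a := dist_triangle_right _ _ _
    _ ≤ η + η := add_le_add h1 h2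
    _ ≤ ε₀ / 4 + ε₀ / 4 := add_le_add (min_le_left _ _) (min_le_left _ _)
    _ < ε₀ := by linarith

/-- `φ` has a limit at every point of the unit circle from within the disc.
[cite: PommerenkeBBCM1992, Thm. 2.1] -/
theorem exists_tendsto_of_norm_eq_one_of_cover (hG : IsOpen G) (hGc : IsPreconnected G)
    (hGb : Bornology.IsBounded G) (hP : Literature.Topology.PlaneTopology.IsUniformlyLocallyConnected P)
    (hfrP : frontier G ⊆ P) (hPG : Disjoint P G) (hζ : ‖ζ‖ = 1) :
    ∃ y, Tendsto φ (𝓝[ball 0 1] ζ) (𝓝 y) := by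
  have hζcl : ζ ∈ closure (ball (0 : ℂ) 1) := by
    rw [closure_ball 0 one_ne_zero, mem_closedBall_zero_iff, hζ]
  haveI : NeBot (𝓝[ball (0 : ℂ) 1] ζ) := mem_closure_iff_nhdsWithin_neBot.1 hζcl
  have hC : Cauchy (map φ (𝓝[ball (0 : ℂ) 1] ζ)) := by
    rw [Metric.cauchy_iff]
    refine ⟨inferInstance, fun ε hε ↦ ?_⟩
    obtain ⟨ρ, hρ, h⟩ := exists_forall_dist_lt_of_cover φ hG hGc hGb hP hfrP hPG hζ hε
    refine ⟨φ '' (ball 0 1 ∩ ball ζ ρ), image_mem_map (inter_mem_nhdsWithin _ (ball_mem_nhds ζ hρ)),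
      ?_⟩
    rintro _ ⟨z, ⟨hz, hzρ⟩, rfl⟩ _ ⟨z', ⟨hz', hz'ρ⟩, rfl⟩
    exact h z hz hzρ z' hz' hz'ρ
  obtain ⟨y, hy⟩ := CompleteSpace.complete hC
  exact ⟨y, hy⟩

/-- `φ` has a limit within the disc at every point of the closed disc.
[cite: PommerenkeBBCM1992, Thm. 2.1] -/
theorem exists_tendsto_of_mem_closedBall_of_cover (hG : IsOpen G) (hGc : IsPreconnected G)
    (hGb : Bornology.IsBounded G) (hP : Literature.Topology.PlaneTopology.IsUniformlyLocallyConnected P)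
    (hfrP : frontier G ⊆ P) (hPG : Disjoint P G) {x : ℂ} (hx : x ∈ closedBall (0 : ℂ) 1) :
    ∃ y, Tendsto φ (𝓝[ball 0 1] x) (𝓝 y) := by
  rcases eq_or_lt_of_le (mem_closedBall_zero_iff.1 hx) with h | h
  · exact exists_tendsto_of_norm_eq_one_of_cover φ hG hGc hGb hP hfrP hPG h
  · exact ⟨φ x, φ.continuousOn x (mem_ball_zero_iff.2 h)⟩

/-- **Carathéodory's continuity theorem, uniformly-locally-connected-cover form** (Pommerenke
(1992), Thm. 2.1, proof of (iv) ⇒ (i)): if `G` is open, preconnected and bounded and some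
uniformly locally connected `P` satisfies `∂G ⊆ P ⊆ ℂ ∖ G`, then a conformal
equivalence `φ : 𝔻 → G` extends continuously to the closed disc: `extendFrom 𝔻 φ` is
continuous on `closedBall 0 1`. [cite: PommerenkeBBCM1992, Thm. 2.1] -/
theorem continuousOn_extendFrom_of_cover (hG : IsOpen G) (hGc : IsPreconnected G)
    (hGb : Bornology.IsBounded G) (hP : Literature.Topology.PlaneTopology.IsUniformlyLocallyConnected P)
    (hfrP : frontier G ⊆ P) (hPG : Disjoint P G) :
    ContinuousOn (extendFrom (ball 0 1) φ) (closedBall (0 : ℂ) 1) :=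
  continuousOn_extendFrom (by rw [closure_ball 0 one_ne_zero])
    fun _ hx ↦ exists_tendsto_of_mem_closedBall_of_cover φ hG hGc hGb hP hfrP hPG hx

/-- Under the hypotheses of `continuousOn_extendFrom_of_cover`, `φ z` tends to the extended
value as `z → x` within the disc, for every `x` in the closed disc. [folklore] -/
theorem tendsto_extendFrom_of_cover (hG : IsOpen G) (hGc : IsPreconnected G)
    (hGb : Bornology.IsBounded G) (hP : Literature.Topology.PlaneTopology.IsUniformlyLocallyConnected P)
    (hfrP : frontier G ⊆ P) (hPG : Disjoint P G) {x : ℂ} (hx : x ∈ closedBall (0 : ℂ) 1) :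
    Tendsto φ (𝓝[ball 0 1] x) (𝓝 (extendFrom (ball 0 1) φ x)) :=
  tendsto_extendFrom (exists_tendsto_of_mem_closedBall_of_cover φ hG hGc hGb hP hfrP hPG hx)

end ConformalEquiv

end Literature.Probability.RandomPlanarGeometry
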